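import Summits.FinalStateConjecture.FinalStateConjecture.Theorems.PhotonSphereChannelsKerrDevDefs
import HarnessLib

/-!
# Route PhotonSphereChannels · crux `ChannelsResolveTameDevelopmentsR` (K2R-T2, stmt-FinalStateConjecture-17430) — posited
# objects of the line `dark-future-exactness` (route-posited definitions, D-0016 `<Route>Defs` convention; pattern of
# `PhotonSphereChannelsTameHullDefs.lean` / `PhotonSphereChannelsKerrDevDefs.lean`)

This file carries no mathematics beyond definitions and their projection API (§1b). It is the local vocabulary (§1 of the registered skeleton
`Cruxes/ChannelsResolveTameDevelopmentsR/Lines/dark_future_exactness.lean`, planner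
planner-cruxplan-stmt-FinalStateConjecture-17430-dark-future-exactnes-0, lead prover-line-stmt-FinalStateConjecture-17430-c7-0)
over which the seven registered stubs `stub_silentHull`, `stub_hullNearKerrIsSlabClose`, `stub_darkFutureExactness`,
`stub_kerrLocusClopen`, `stub_someLimitIsKerr`, `stub_tameEndgame`, `stub_settledExteriorHoldsRays` of crux
stmt-FinalStateConjecture-17430 are stated, moved VERBATIM (same short names, same bodies, same docstrings) out of the crux
workfile into the landed hull namespace `…Theorems.TameHull` (which the skeleton `open`s, so the registered stub texts are
unchanged) so that stub proofs and stub consequences can be landed as `Theorems/…` files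
(`--supports stmt-FinalStateConjecture-17430`) importing it:

* ends: `IsTameEndOrder` (tame at order `k`), `IsTameClass` (all orders, uniform far constants `E.R, E.C ≤ Λ 0`),
  `penetratingBackground` (Kerr–Schild `(M, a)` on `{r > ρ}`, depth `ρ`), `exteriorWindow`, `IsExteriorWindowClose` (the producer P's
  hypothesis), `IsSlabClose` (the bridge B's hypothesis: one penetrating chart from depth `ρ`, one clock-epoch of the d.o.c.
  covered, `r`-weighted `C^k` smallness; Reshape 1 of the lead: depth parameter), `IsEventuallyKerrDoc` (B1's conclusion);
* developments: `IsSilentHullElement`, `horizonOf`, `IsHorizonPath`, `IsHorizonHullElementAlong`, `IsHorizonHullElement`,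
  `OuterHullExists`, `GeneratorHullExists`, `OuterHullShadowed` (the clauses of stub A), `WindowIsolationAlong`
  (the conclusion of `P ∘ B`, the openness input of K).

Everything is a definition over EXISTING declarations (`TameHull.EndDatum/IsTameEnd/IsKerrDoc/IsFutureEscaping/outerRegion/DevHyp`
of `PhotonSphereChannelsTameHullDefs`, `TameHull.EndDatum.IsSilent` of `PhotonSphereChannelsKerrDevDefs`,
`Kerr.region/exterior/bilin/radius/rPlus/background`, `supCkENorm`, `Spacetime.deviation(Extend)`, `IsLateChart`,
`Minkowski.backgroundOn`, `CauchyDevelopment.eventHorizonOf`, `Spacetime.SubconvergesLocallyTo`); nothing here restates a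
route item or a stub (the closed `Prop`s `SilentHull`, …, `SettledExteriorHoldsRays` and the cut `ForwardExactness` /
`BackwardExtension` stay in the crux workfile until proved). This module deliberately does NOT import the route file
`Theses.PhotonSphereChannels` (closing modules must stay importable by it).
-/

noncomputable section

-- the operator-norm instance on `E4 →L[ℝ] E4 →L[ℝ] ℝ` needs one more level of pending
-- instance problems than the default (as in `PhotonSphereChannelsTameHullDefs.lean`)
set_option maxSynthPendingDepth 3
-- every `Summit.FinalStateConjecture.FinalStateConjecture.…` name repeats the summit = sub-problem segment (D-0017 layout)
set_option linter.dupNamespace false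

open Set Filter Function TopologicalSpace Manifold Bundle
open scoped Topology Manifold ContDiff ENNReal NNReal

namespace Summit.FinalStateConjecture.FinalStateConjecture.Theorems.TameHull

open Literature.Geometry.Lorentzian

/-! ### §1 Local vocabulary of the line `dark-future-exactness` (skeleton §1, verbatim) -/

section Ends

variable {𝓢 : Spacetime.{0} 4}

/-- **Tame at order `k`** (the two quantitative clauses of `TameHull.EndDatum.IsTameEnd` with `3 ↦ k`):
`‖D^m h‖ · r ≤ Λ` on the eternal far cylinder for `m ≤ k`, and CLOCK-ADAPTED centred tame balls of
radius `r₀` at every point of the d.o.c. with `C^k`-deviation `≤ Λ`, `C⁰`-deviation `≤ 1/2`.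
`IsTameEndOrder E 3 Λ r₀` are exactly the clauses `far_bound`, `tame` of `IsTameEnd Λ r₀`.
[cite: Anderson2004, Def. 1.1 and Thm 5.1] -/
structure IsTameEndOrder (E : EndDatum 𝓢) (k : ℕ) (Λ : ℝ≥0) (r₀ : ℝ) : Prop where
  /-- `‖D^m h‖ · r ≤ Λ` on the whole far cylinder for `m ≤ k`. -/
  far_bound : ∀ m ≤ k, ∀ x : Kerr.region (0 : ℝ) E.R,
    ‖iteratedFDeriv ℝ m E.h x.1‖ * Kerr.radius 0 x.1 ≤ Λ
  /-- Clock-adapted centred tame balls with `C^k`-deviation `≤ Λ` at every point of the d.o.c. -/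
  tame : ∀ q ∈ E.doc,
    let U : Opens E4 := ⟨Metric.ball (0 : E4) r₀, Metric.isOpen_ball⟩
    ∃ Ψ : U → 𝓢.carrier, 𝓢.IsLateChart (Minkowski.backgroundOn U) Set.univ (-r₀) Ψ ∧
      (∃ x : U, (x : E4) = 0 ∧ Ψ x = q) ∧
      supCkENorm (U : Set E4) k (𝓢.deviationExtend (Minkowski.backgroundOn U) Ψ) ≤ (Λ : ℝ≥0∞) ∧
      supCkENorm (U : Set E4) 0 (𝓢.deviationExtend (Minkowski.backgroundOn U) Ψ) ≤ 1 / 2 ∧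
      (∀ x : U, 𝓢.timeOrientation.IsFutureDirected
        (mfderiv 𝓘(ℝ, E4) (𝓡 4) Ψ x (E4.basisVector 0))) ∧
      ∀ x : U, E.clock (Ψ x) = (x : E4) 0 + E.clock q

/-- **All-orders tameness class `(Λ, r₀)`**, `Λ : ℕ → ℝ≥0`: the end is an eternal `(Λ 3, r₀)`-tame
vacuum end (`IsTameEnd`: the full `C³` interface incl. vacuum, far chart, clock), its far-chart constants
are UNIFORMLY bounded (`E.R ≤ Λ 0`, `E.C ≤ Λ 0` — no far companion can hide beyond the far chart's inner
radius, TRIAGE-r2-2 (c) / r2-3 (2)), and it is tame at EVERY order `k` with constant `Λ k` (Finding G of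
TRIAGE-r2-3: every engine of the line needs more than the crux's `C³`). [cite: Anderson2004, Def. 1.1 and Thm 5.1] -/
structure IsTameClass (E : EndDatum 𝓢) (Λ : ℕ → ℝ≥0) (r₀ : ℝ) : Prop where
  /-- The `C³` interface of `TameHull`. -/
  isTameEnd : E.IsTameEnd (Λ 3) r₀
  /-- Uniform inner radius of the far chart. -/
  R_le : E.R ≤ ((Λ 0 : ℝ≥0) : ℝ)
  /-- Uniform weighted far constant. -/
  C_le : E.C ≤ ((Λ 0 : ℝ≥0) : ℝ)
  /-- Tame at every order. -/
  order : ∀ k : ℕ, IsTameEndOrder E k (Λ k) r₀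

/-- The horizon-PENETRATING Kerr–Schild background `(Kerr.region a ρ, g_{M,a}, t* = x⁰, r)` on
`{r > ρ}` from DEPTH `ρ` (used with `r₋ < ρ < r₊`: the slice `{t* = 0} ∩ {r > ρ}` is a
Klainerman–Szeftel slice `Kerr.slice a ρ`; Reshape 1 of lead c7: the depth is a parameter, the
original text had `ρ = M = (r₋ + r₊)/2`). [cite: KlainermanSzeftel2023, §3.1.1] -/
def penetratingBackground (M a ρ : ℝ) : ModelBackground :=
  ⟨Kerr.region a ρ, Kerr.bilin M a, fun x ↦ x 0, Kerr.radius a⟩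

/-- The EXTERIOR window `{r₊ + η < r < W, |t*| < W}` of the Kerr exterior `(M, a)` (ingoing Kerr–Schild
chart): bounded in time and radius, at distance `η` OUTSIDE the event horizon (no collar: the test K
runs on elements near a Kerr-d.o.c. element only sees the exterior, `Negative/KerrIsolationClosurePoints`). [cite: DafermosLuk2017, §1.2.1] -/
def exteriorWindow (M a W η : ℝ) : Set (Kerr.exterior M a) :=
  {x | Kerr.rPlus M a + η < Kerr.radius a x.1 ∧ Kerr.radius a x.1 < W ∧ |x.1 0| < W}

/-- **The end `E` of `𝓢` contains an exterior window `(W, η, δ)`-close to Kerr `(M, a)`**: a map `Ψ`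
of the Kerr exterior (only its values on the window matter), smooth and injective on the window,
mapping the window INTO the domain of outer communications `E.doc`, with `C²` sup deviation
`sup_window ‖D^m(Ψ^*g − g_{M,a})‖ ≤ δ`, and `Ψ_* ∂_{t*}` future-directed outside the ergoregion.
NOT anchored at a base point (the curvature of the near-horizon Kerr exterior anchors it; far re-based
views are never `δ`-close for `δ < c(M, η)` — KID's inertness does not arise). This is what pointed `C²`
convergence to an exactly-Kerr element delivers, at any chart-time translate. [cite: DafermosLuk2017, §1.2.1] -/
def IsExteriorWindowClose (𝓢 : Spacetime.{0} 4) (E : EndDatum 𝓢) (M a W η δ : ℝ) : Prop :=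
  ∃ Ψ : Kerr.exterior M a → 𝓢.carrier,
    ContMDiffOn 𝓘(ℝ, E4) (𝓡 4) ∞ Ψ (exteriorWindow M a W η) ∧ Set.InjOn Ψ (exteriorWindow M a W η) ∧
    Set.MapsTo Ψ (exteriorWindow M a W η) E.doc ∧
    supCkENorm (Subtype.val '' exteriorWindow M a W η) 2
        (𝓢.deviationExtend (Kerr.background M a) Ψ) ≤ ENNReal.ofReal δ ∧
      ∀ x ∈ exteriorWindow M a W η, 2 * M < Kerr.radius a x.1 →
        𝓢.timeOrientation.IsFutureDirected (mfderiv 𝓘(ℝ, E4) (𝓡 4) Ψ x (E4.basisVector 0))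

/-- **Slab closeness from depth `ρ`** `IsSlabClose 𝓢 E M a ρ k β c δ` (the hypothesis of the bridge B,
TRIAGE-r2-1/2/3 `sharpen` applied: weighted, finite but arbitrary order, slab-only coverage, chart tied
to `E.doc`; Reshape 1 of lead c7: DEPTH PARAMETER `ρ`, used with `r₋ < ρ < r₊`): ONE injective smooth
chart `Ψ` of the horizon-PENETRATING region `{r > ρ}` of Kerr `(M, a)` into `𝓢`, future-oriented
outside the ergoregion, whose exterior part `{r > r₊}` maps INTO `E.doc`, which COVERS the unit epoch
`{q ∈ E.doc | |clock q − c| < 1}` of the end's own clock by its exterior chart slab `{r > r₊, |t*| < 2}`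
(global on that epoch: a far companion or a second end is not hidden — unlike a window), and along
which, on the chart slab `{|t*| < 2}` INCLUDING THE COLLAR `{ρ < r ≤ r₊}`, the `r`-WEIGHTED `C^k`
deviation is small: `‖D^m(Ψ^*g − g_{M,a})‖ · r^{β+m} ≤ δ` for `m ≤ k` (derivative gain built in;
`β < 2` in use = strictly below the mass order, so only mass/boost/translation need be absorbed into
`Ψ`, which the `∃ Ψ` allows — TRIAGE-r2-2 `sharpen`). Global coverage of `E.doc` is an OUTPUT of B,
not an input. WHY A DEPTH PARAMETER (stub-worker P, lead c7, kernel-checked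
`not_hullNearKerrIsSlabClose_of_trimWitness`): hull elements carry no covering clause
(`Spacetime.SubconvergesLocallyTo.restrict'`), so a horizon-hull element may be TRIMMED to any open
set keeping its closed d.o.c., far chart and tame balls — a collar of Kerr–Schild depth `≈ c·r₀` below
`r₊` and no more; the original depth `ρ = M = (r₋ + r₊)/2` (`≫ r₀` below `r₊`) made the producer P
false on every trimmed Kerr-d.o.c. element (Kretschmann pinning). The producer now ANNOUNCES a depth
inside the pinned collar and the bridge B works from every depth `ρ ∈ (r₋, r₊)`, exactly as the
vendored `klainerman_szeftel_kerr_stability_small_a_cauchy` (`∀ r₀ ∈ Ioo r₋ r₊`). [cite: KlainermanSzeftel2023, Thm. 1.2.1] -/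
def IsSlabClose (𝓢 : Spacetime.{0} 4) (E : EndDatum 𝓢) (M a ρ : ℝ) (k : ℕ) (β c δ : ℝ) : Prop :=
  ∃ Ψ : Kerr.region a ρ → 𝓢.carrier, Function.Injective Ψ ∧ ContMDiff 𝓘(ℝ, E4) (𝓡 4) ∞ Ψ ∧
    (∀ x : Kerr.region a ρ, Kerr.rPlus M a < Kerr.radius a x.1 → Ψ x ∈ E.doc) ∧
    (∀ q ∈ E.doc, |E.clock q - c| < 1 →
      ∃ x : Kerr.region a ρ, Kerr.rPlus M a < Kerr.radius a x.1 ∧ |x.1 0| < 2 ∧ Ψ x = q) ∧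
    (∀ m ≤ k, ∀ x : Kerr.region a ρ, |x.1 0| < 2 →
      ‖iteratedFDeriv ℝ m (𝓢.deviationExtend (penetratingBackground M a ρ) Ψ) x.1‖ *
        Kerr.radius a x.1 ^ (β + (m : ℝ)) ≤ δ) ∧
    ∀ x : Kerr.region a ρ, 2 * M < Kerr.radius a x.1 →
      𝓢.timeOrientation.IsFutureDirected (mfderiv 𝓘(ℝ, E4) (𝓡 4) Ψ x (E4.basisVector 0))

/-- **Eventually exactly Kerr d.o.c.** (the output of B1, the input of B2): an injective smooth chart of
the Kerr exterior `(M, a)` INTO `E.doc`, pulling `g` back EXACTLY to `g_{M,a}`, future-oriented outside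
the ergoregion, whose range contains the whole late part `{q ∈ E.doc | clock q > T}` of the d.o.c.
`IsKerrDoc` is the case "`range Ψ = E.doc`". [cite: DafermosLuk2017, Conjecture 1] -/
def IsEventuallyKerrDoc (𝓢 : Spacetime.{0} 4) (E : EndDatum 𝓢) (M a : ℝ) : Prop :=
  ∃ (T : ℝ) (Ψ : Kerr.exterior M a → 𝓢.carrier), Function.Injective Ψ ∧
    ContMDiff 𝓘(ℝ, E4) (𝓡 4) ∞ Ψ ∧ Set.range Ψ ⊆ E.doc ∧
    {q | q ∈ E.doc ∧ T < E.clock q} ⊆ Set.range Ψ ∧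
    (∀ x, 𝓢.deviation (Kerr.background M a) Ψ x = 0) ∧
      ∀ x : Kerr.exterior M a, 2 * M < Kerr.radius a x.1 →
        𝓢.timeOrientation.IsFutureDirected (mfderiv 𝓘(ℝ, E4) (𝓡 4) Ψ x (E4.basisVector 0))

end Ends

section Development

variable {X : Type} [TopologicalSpace X] [ChartedSpace E3 X] [IsManifold (𝓡 3) ∞ X]
  [T2Space X] [SecondCountableTopology X] [ConnectedSpace X] {D : InitialDataSet (𝓡 3) X}

/-- **Silent outer hull element** in the all-orders class `(Λ, r₀)`: a future-escaping sequence of OUTER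
base points `q` (`TameHull.IsFutureEscaping`), an end `(𝓢, E)` in the class which is SILENT
(`EndDatum.IsSilent`: two-sided non-radiating at order `1/r`, non-expanding shear-free horizon, red-shifted
or cold), a base point `p` in the CLOSED d.o.c., and pointed `C²_loc` subconvergence `(𝒟, qₙ) ⇀ (𝓢, p)`.
[cite: Anderson2004, Def. 1.1] -/
def IsSilentHullElement (𝒟 : VacuumCauchyDevelopment D) [𝒟.metric.HasLeviCivita] (Λ : ℕ → ℝ≥0)
    (r₀ : ℝ) (q : ℕ → 𝒟.carrier) (𝓢 : Spacetime.{0} 4) (E : EndDatum 𝓢) (p : 𝓢.carrier) : Prop :=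
  IsFutureEscaping 𝒟 q ∧ IsTameClass E Λ r₀ ∧ E.IsSilent ∧ p ∈ closure E.doc ∧
    Spacetime.SubconvergesLocallyTo (fun _ ↦ 𝒟.toSpacetime) q 𝓢 p 2

/-- The **future event horizon of the development**: `𝓗⁺ = ∂I⁻(outer region) ∩ J⁺(ι X)`
(`CauchyDevelopment.eventHorizonOf` of `TameHull.outerRegion`; IKCH's `horizonOf`, verbatim). [cite: HawkingEllis1973, §9.2] -/
def horizonOf (𝒟 : VacuumCauchyDevelopment D) [𝒟.metric.HasLeviCivita] : Set 𝒟.carrier :=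
  𝒟.toCauchyDevelopment.eventHorizonOf (outerRegion 𝒟)

/-- **Horizon generator path** of the development (the BASE PATHS of the clopen step; IKCH's
`IsHorizonPath`, verbatim): a continuous causal curve `γ : ℝ → 𝓗⁺` in the closure of the outer region,
FUTURE-ESCAPING (it eventually leaves `J⁻(K)` for every compact `K`). Basing on the horizon is what makes
the Kerr locus CLOSED in the based hull (the hole cannot recede from the base point). [cite: Wald1984, §12.1] -/
def IsHorizonPath (𝒟 : VacuumCauchyDevelopment D) [𝒟.metric.HasLeviCivita]
    (γ : ℝ → 𝒟.carrier) : Prop :=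
  Continuous γ ∧ (∀ s, γ s ∈ horizonOf 𝒟) ∧ (∀ s, γ s ∈ closure (outerRegion 𝒟)) ∧
    (∀ s s' : ℝ, s ≤ s' → γ s' ∈ 𝒟.metric.causalFuture 𝒟.timeOrientation {γ s}) ∧
      ∀ K : Set 𝒟.carrier, IsCompact K →
        ∀ᶠ s in atTop, γ s ∉ 𝒟.metric.causalPast 𝒟.timeOrientation K

/-- **Horizon-hull element along the parameter sequence `s`** of the generator path `γ`: a SILENT end in
the all-orders class `(Λ, r₀)` with base point `p` ON ITS OWN HORIZON (horizon lineage) to which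
`(𝒟, γ(sₙ))` subconverges in the pointed `C²_loc` sense. [cite: Anderson2004, Def. 1.1] -/
def IsHorizonHullElementAlong (𝒟 : VacuumCauchyDevelopment D) [𝒟.metric.HasLeviCivita]
    (Λ : ℕ → ℝ≥0) (r₀ : ℝ) (γ : ℝ → 𝒟.carrier) (s : ℕ → ℝ) (𝓢 : Spacetime.{0} 4) (E : EndDatum 𝓢)
    (p : 𝓢.carrier) : Prop :=
  IsTameClass E Λ r₀ ∧ E.IsSilent ∧ p ∈ E.horizon ∧
    Spacetime.SubconvergesLocallyTo (fun _ ↦ 𝒟.toSpacetime) (γ ∘ s) 𝓢 p 2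

/-- **Horizon-hull element along `γ`** (member of the BASED HULL `Ω_γ`): a horizon-hull element along
some `sₙ → +∞`. [cite: Hale1980, Ch. I §8] -/
def IsHorizonHullElement (𝒟 : VacuumCauchyDevelopment D) [𝒟.metric.HasLeviCivita]
    (Λ : ℕ → ℝ≥0) (r₀ : ℝ) (γ : ℝ → 𝒟.carrier) (𝓢 : Spacetime.{0} 4) (E : EndDatum 𝓢)
    (p : 𝓢.carrier) : Prop :=
  ∃ s : ℕ → ℝ, Tendsto s atTop atTop ∧ IsHorizonHullElementAlong 𝒟 Λ r₀ γ s 𝓢 E p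

/-- Clause (a) of stub A: silent outer hull elements exist along every future-escaping outer sequence.
[cite: Anderson2004, Thm 5.1] -/
def OuterHullExists (𝒟 : VacuumCauchyDevelopment D) [𝒟.metric.HasLeviCivita] (Λ : ℕ → ℝ≥0)
    (r₀ : ℝ) : Prop :=
  ∀ q : ℕ → 𝒟.carrier, IsFutureEscaping 𝒟 q →
    ∃ (𝓢 : Spacetime.{0} 4) (E : EndDatum 𝓢) (p : 𝓢.carrier), IsSilentHullElement 𝒟 Λ r₀ q 𝓢 E p

/-- Clause (b) of stub A (PRECOMPACTNESS of the generator hull): along every horizon generator path and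
every `sₙ → +∞` there is a horizon-hull element. [cite: Anderson2004, Thm 5.1] -/
def GeneratorHullExists (𝒟 : VacuumCauchyDevelopment D) [𝒟.metric.HasLeviCivita] (Λ : ℕ → ℝ≥0)
    (r₀ : ℝ) : Prop :=
  ∀ γ : ℝ → 𝒟.carrier, IsHorizonPath 𝒟 γ → ∀ s : ℕ → ℝ, Tendsto s atTop atTop →
    ∃ (𝓢 : Spacetime.{0} 4) (E : EndDatum 𝓢) (p : 𝓢.carrier),
      IsHorizonHullElementAlong 𝒟 Λ r₀ γ s 𝓢 E p

/-- Clause (c) of stub A (SHADOWING): an outer silent hull element whose end has a nonempty future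
horizon is, re-based on that horizon, a horizon-hull element along some generator path of `𝒟` (in
particular horizon generator paths EXIST as soon as one hull element has a horizon). [folklore] -/
def OuterHullShadowed (𝒟 : VacuumCauchyDevelopment D) [𝒟.metric.HasLeviCivita] (Λ : ℕ → ℝ≥0)
    (r₀ : ℝ) : Prop :=
  ∀ (q : ℕ → 𝒟.carrier) (𝓢 : Spacetime.{0} 4) (E : EndDatum 𝓢) (p : 𝓢.carrier),
    IsSilentHullElement 𝒟 Λ r₀ q 𝓢 E p → E.horizon.Nonempty →
      ∃ (γ : ℝ → 𝒟.carrier) (p' : 𝓢.carrier), IsHorizonPath 𝒟 γ ∧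
        IsHorizonHullElement 𝒟 Λ r₀ γ 𝓢 E p'

/-- **Window isolation along generators** (the conclusion of `P ∘ B`, the openness input of K): along
every horizon generator path, for every SUB-EXTREMAL `(M, a)` and tolerance `ε` there is an exterior
window size `(W, η, δ)` such that every horizon-hull element containing an exterior window
`(W, η, δ)`-close to Kerr `(M, a)` has a d.o.c. EXACTLY Kerr `(M', a')` with
`|M' − M| + |a' − a| ≤ ε`. Derived in §4 from P and B by logic; never a stub. [cite: DafermosLuk2017, §1.2.1] -/
def WindowIsolationAlong (𝒟 : VacuumCauchyDevelopment D) [𝒟.metric.HasLeviCivita] (Λ : ℕ → ℝ≥0)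
    (r₀ : ℝ) : Prop :=
  ∀ γ : ℝ → 𝒟.carrier, IsHorizonPath 𝒟 γ → ∀ M a : ℝ, 0 < M → |a| < M → ∀ ε > (0 : ℝ),
    ∃ W η δ : ℝ, 0 < η ∧ 0 < δ ∧
      ∀ (𝓢 : Spacetime.{0} 4) (E : EndDatum 𝓢) (p : 𝓢.carrier),
        IsHorizonHullElement 𝒟 Λ r₀ γ 𝓢 E p → IsExteriorWindowClose 𝓢 E M a W η δ →
          ∃ M' a' : ℝ, 0 < M' ∧ |a'| < M' ∧ |M' - M| + |a' - a| ≤ ε ∧ IsKerrDoc 𝓢 E.doc M' a'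

end Development

/-! ### §1b Basic API of the posited objects (projections; used by every stub file) -/

section API

variable {X : Type} [TopologicalSpace X] [ChartedSpace E3 X] [IsManifold (𝓡 3) ∞ X]
  [T2Space X] [SecondCountableTopology X] [ConnectedSpace X] {D : InitialDataSet (𝓡 3) X}

/-- A silent hull element of the all-orders class `(Λ, r₀)` is a hull element of the `C³` interface
`TameHull.IsHullElement` at `(Λ 3, r₀)` (projection; registered sub-goal
`isHullElement_of_isSilentHullElement` of stmt-FinalStateConjecture-17430 — the API lemma letting the landed
hull machinery `…RHullSubsequences` / `…RHullRebasing` / `…RSilentHullDictionary` act on the line's elements). [folklore] -/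
theorem isHullElement_of_isSilentHullElement : ∀ {X : Type} [TopologicalSpace X] [ChartedSpace E3 X] [IsManifold (𝓡 3) ∞ X] [T2Space X] [SecondCountableTopology X] [ConnectedSpace X] {D : InitialDataSet (𝓡 3) X} (𝒟 : VacuumCauchyDevelopment D) [𝒟.metric.HasLeviCivita] (Λ : ℕ → ℝ≥0) (r₀ : ℝ) (q : ℕ → 𝒟.carrier) (𝓢 : Spacetime.{0} 4) (E : EndDatum 𝓢) (p : 𝓢.carrier), IsSilentHullElement 𝒟 Λ r₀ q 𝓢 E p → IsHullElement 𝒟 (Λ 3) r₀ q 𝓢 E p :=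
  fun _ _ _ _ _ _ _ _ h ↦ ⟨h.1, h.2.1.isTameEnd, h.2.2.2.2⟩

omit [T2Space X] [SecondCountableTopology X] in
/-- A horizon-hull element along a divergent parameter sequence is a member of the based hull `Ω_γ`
(packaging of `IsHorizonHullElement`). [folklore] -/
theorem IsHorizonHullElementAlong.isHorizonHullElement {𝒟 : VacuumCauchyDevelopment D}
    [𝒟.metric.HasLeviCivita] {Λ : ℕ → ℝ≥0} {r₀ : ℝ} {γ : ℝ → 𝒟.carrier} {s : ℕ → ℝ}
    {𝓢 : Spacetime.{0} 4} {E : EndDatum 𝓢} {p : 𝓢.carrier}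
    (h : IsHorizonHullElementAlong 𝒟 Λ r₀ γ s 𝓢 E p) (hs : Tendsto s atTop atTop) :
    IsHorizonHullElement 𝒟 Λ r₀ γ 𝓢 E p :=
  ⟨s, hs, h⟩

end API

/-- Slab closeness is monotone in the tolerance (the weighted bounds are `≤ δ`). [folklore] -/
theorem IsSlabClose.mono {𝓢 : Spacetime.{0} 4} {E : EndDatum 𝓢} {M a ρ : ℝ} {k : ℕ} {β c δ δ' : ℝ}
    (h : IsSlabClose 𝓢 E M a ρ k β c δ) (hδ : δ ≤ δ') : IsSlabClose 𝓢 E M a ρ k β c δ' := by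
  obtain ⟨Ψ, hinj, hsm, hdoc, hcov, hdev, hfut⟩ := h
  exact ⟨Ψ, hinj, hsm, hdoc, hcov, fun m hm x hx ↦ (hdev m hm x hx).trans hδ, hfut⟩

end Summit.FinalStateConjecture.FinalStateConjecture.Theorems.TameHull

end
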